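import Summits.AtomisticToContinuum.FouriersLaw.Theorems.HonestZwanzigRobinCoercivityStubFeshbachIdentities

/-!
# HonestZwanzig / OrthogonalOhm, line `Sketch`: stub R0 `stub_feshbachIdentities`

The route support item `HonestZwanzig.FeshbachIdentities` (stmt-AtomisticToContinuum-12697) — the fixed-`N` package
(Gibbs invariance of the transition kernels; integrability and `L¹((0,∞))` correlations of `Adm` observables; time
reversal of `corr`; the two Kolmogorov identities against the split site energies; positive definiteness of `Cov(e,e)`
and of `G(s)`) — is already proved in the tree, assembled from the landed parts `HonestZwanzigFeshbachIdentities*` by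
`Summit.AtomisticToContinuum.FouriersLaw.Theorems.HonestZwanzig.Robin.stub_feshbachIdentities`
(`…HonestZwanzigRobinCoercivityStubFeshbachIdentities`, stub 1 of line `LinAlg` of crux `RobinCoercivity`). This file
records the registered stub R0 of line `Sketch` of crux `OrthogonalOhm` (stmt-AtomisticToContinuum-12693) under its
registered name, by that theorem.
-/

namespace Summit.AtomisticToContinuum.FouriersLaw.Theorems.HonestZwanzig

/-- **Stub R0 / route item `FeshbachIdentities`** (stmt-AtomisticToContinuum-12697): for `pinnedChain ω₂ lam β γ` (all
parameters positive), `T > 0`, `N ≥ 2` — (0) Gibbs invariance of the equilibrium transition kernels, (i) integrability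
of `Adm` observables, of the correlation integrand and of `corr(f,g)` on `(0,∞)`, (ii) time reversal
`corr(f,g)(t) = corr(g∘Θ, f∘Θ)(t)`, (iii) the Kolmogorov identities `s·lap_s(e_x,g) − Cov(e_x,g) = lap_s((Le_x)∘Θ, g)`,
`s·lap_s(f,e_x) − Cov(f,e_x) = lap_s(f, Le_x)`, (iv) positive definiteness of `Cov(e,e)` and of `G(s)` (`s > 0`).
This is `Robin.stub_feshbachIdentities` (the assembly of the landed `FeshbachIdentities` parts). -/
theorem stub_feshbachIdentities : Summit.AtomisticToContinuum.FouriersLaw.Theses.HonestZwanzig.FeshbachIdentities :=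
  Robin.stub_feshbachIdentities

end Summit.AtomisticToContinuum.FouriersLaw.Theorems.HonestZwanzig
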